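import Summits.BirchSwinnertonDyer.Rank1Residual.Additive.KobayashiLogFss
import Summits.BirchSwinnertonDyer.Rank1Residual.Additive.PadicBallFubini
import Mathlib.Analysis.Normed.Ring.InfiniteSum
import Mathlib.Data.Nat.Choose.Sum
import HarnessLib

/-!
# The values of Kobayashi's logarithm: `log_{F_ss}(x) = ∑ₖ (−1)ᵏ((1+x)^{p^{2k}} − 1)/pᵏ` at every
# point `‖x‖ < 1` of a complete ultrametric normed `ℚ_p`-algebra (rearrangement), the finite form
# when `(1+x)^{p^{2k}} = 1` eventually (roots of unity), and the CONGRUENCE form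
# `log_{F_ss}(x) ∈ K' + 𝒪_K` when `p`-th powers of `𝒪_K` lie in `𝒪_{K'} + p𝒪_K`
# (cell `b2b-bsdres`, CLASS-CLOSURE lane, class O10 — x1b GEN 33, class lead; file 28 of the local
# series: the two uses of the explicit logarithm in [K] Lemma 8.9 / Prop. 8.11)

HONEST FRAMING (cell `b2b-bsdres`, run/shared/lean/b2b/bsd-rank1-residual/, verbatim in every
file): the goal of the cell is to DELETE the COMBINATION-SHAPED residual classes of the
Birch–Swinnerton-Dyer formula for ALL analytic-rank `≤ 1` elliptic curves over `ℚ` — "full BSD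
formula for every rank `≤ 1` curve in class `C`" assembled STRICTLY from published theorems — so
that the rank-`≤ 1` remainder becomes exactly the CONSTRUCTION-SHAPED classes, which are TYPED
(missing-input `Prop`s), NOT attempted. This is not "finishing BSD". CLASS-CLOSURE lane: prove
what is provable now; shrink each hard class to its core with data; no claim beyond stated classes;
research routes on CONSTRUCTION-SHAPED X12 / O10; census / instrument output = EVIDENCE / conjecture
items, NEVER a Literature fact; `RESIDUAL-MAP.md` marks change only by signed lines. THIS FILE:
TOOL DEFINITION + THEOREMS (one definition with body: `logFssRow`, the `k`-th summand
`(−1)ᵏ((1+x)^{p^{2k}} − 1)/pᵏ`; every statement proved) — no named Literature fact, no Summits-side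
fact `def … : Prop`, no `sorry`, axioms standard; nothing is booked; no label / mark / count /
sub-cell moves; O10 stays OPEN / CONSTRUCTION-SHAPED; nothing about `BSD(W, p)` of any pair is
claimed.

## Content (`K` complete ultrametric normed `ℚ_p`-algebra and field, `‖x‖ < 1`)

* §1 the double family `(k, d) ↦ logFssTerm k d · xᵈ` is summable (`‖·‖ ≤ d p⁻ᵏ ‖x‖ᵈ`), its rows
  sum to `logFssRow x k = (−1)ᵏ((1+x)^{p^{2k}} − 1)/pᵏ` (binomial theorem) and its columns to
  `[Xᵈ]log_{F_ss} · xᵈ`.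
* §2 **`hasSum_logFssRow`: `∑ₖ logFssRow x k = qEval log_{F_ss} x`** ([K] §8.2 read at a point);
  `qEval_logFss_eq_sum_of_pow_eq_one`: the finite form when `(1+x)^{p^{2k}} = 1` for `k ≥ k₀`.
* §3 **`exists_mem_norm_qEval_logFss_sub_le_one`**: if every `y ∈ 𝒪_K` has `yᵖ ∈ s + p𝒪_K` with
  `s ∈ K' ∩ 𝒪_K` (`K'` a subfield), then `log_{F_ss}(x) ∈ K' + 𝒪_K` for all `‖x‖ < 1`
  (`(1+x)^{p^{2k}} ∈ K' ∩ 𝒪 + p^{2k}𝒪`, so the `k`-th row is in `K' + pᵏ𝒪`; the tail is small).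

References: [Kobayashi2003] §8.2, Lemma 8.9, Prop. 8.11 (proof); [Honda1970] §2.
-/

noncomputable section

open scoped Classical Topology
open Filter PowerSeries Finset

namespace Summit.BirchSwinnertonDyer.Rank1Residual.Additive

namespace HondaFss

open BallEval

variable (p : ℕ) [hp : Fact p.Prime] (K : Type*) [NontriviallyNormedField K] [NormedAlgebra ℚ_[p] K]
  [IsUltrametricDist K] [CompleteSpace K]

/-! ## §1 The double family -/

/-- **The `k`-th summand `(−1)ᵏ((1+x)^{p^{2k}} − 1)/pᵏ` of `log_{F_ss}(x)`.** [cite: Kobayashi2003, §8.2] -/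
def logFssRow (x : K) (k : ℕ) : K := (-1) ^ k * ((1 + x) ^ p ^ (2 * k) - 1) / (p : K) ^ k

variable {p K}

omit [IsUltrametricDist K] [CompleteSpace K] in
/-- `‖p‖ = p⁻¹` in `K`. [folklore] -/
theorem norm_natCast_p : ‖(p : K)‖ = (p : ℝ)⁻¹ := by
  have h : (p : K) = algebraMap ℚ_[p] K (p : ℚ_[p]) := by rw [map_natCast]
  rw [h, norm_algebraMap_padic, Padic.norm_p]

omit [IsUltrametricDist K] [CompleteSpace K] in
/-- The row as a finite sum of the terms: `logFssRow x k = ∑_{d ≤ p^{2k}} logFssTerm k d · xᵈ`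
(binomial theorem). [folklore] -/
theorem logFssRow_eq_sum (x : K) (k : ℕ) :
    logFssRow p K x k = ∑ d ∈ range (p ^ (2 * k) + 1), algebraMap ℚ_[p] K (logFssTerm p k d) * x ^ d := by
  have hp0 : (p : K) ≠ 0 := by
    rw [← norm_pos_iff, norm_natCast_p]; exact inv_pos.mpr (by exact_mod_cast hp.out.pos)
  rw [logFssRow, add_comm (1 : K) x, add_pow]
  simp only [one_pow, mul_one]
  -- `∑ x^d C(N,d) − 1 = ∑ (C(N,d) − [d=0]) x^d`
  have h1 : (∑ d ∈ range (p ^ (2 * k) + 1), x ^ d * ((p ^ (2 * k)).choose d : K)) - 1 =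
      ∑ d ∈ range (p ^ (2 * k) + 1), (((p ^ (2 * k)).choose d : K) - if d = 0 then 1 else 0) * x ^ d := by
    have hone : (1 : K) = ∑ d ∈ range (p ^ (2 * k) + 1), (if d = 0 then (1 : K) else 0) * x ^ d := by
      rw [Finset.sum_eq_single 0 (fun d _ hd => by rw [if_neg hd, zero_mul]) (fun h => absurd (by simp) h)]
      simp
    conv_lhs => rw [hone, ← Finset.sum_sub_distrib]
    refine Finset.sum_congr rfl fun d _ => ?_
    split_ifs <;> ring
  rw [h1, div_eq_mul_inv, Finset.mul_sum, Finset.sum_mul]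
  refine Finset.sum_congr rfl fun d _ => ?_
  rw [logFssTerm, map_div₀, map_mul, map_pow, map_neg, map_one, map_sub, map_natCast, map_pow, map_natCast]
  split_ifs with hd
  · rw [map_one]; field_simp
  · rw [map_zero]; field_simp

omit [IsUltrametricDist K] [CompleteSpace K] in
/-- The terms of the row vanish beyond `d = p^{2k}`. [folklore] -/
theorem logFssTerm_eq_zero_of_lt {k d : ℕ} (h : p ^ (2 * k) < d) : logFssTerm p k d = 0 := by
  rw [logFssTerm, Nat.choose_eq_zero_of_lt h, if_neg (by omega)]
  simp

omit [IsUltrametricDist K] [CompleteSpace K] in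
/-- Row sums: `∑_d logFssTerm k d · xᵈ = logFssRow x k`. [folklore] -/
theorem hasSum_row (x : K) (k : ℕ) :
    HasSum (fun d : ℕ => algebraMap ℚ_[p] K (logFssTerm p k d) * x ^ d) (logFssRow p K x k) := by
  rw [logFssRow_eq_sum]
  refine hasSum_sum_of_ne_finset_zero fun d hd => ?_
  rw [mem_range, not_lt] at hd
  rw [logFssTerm_eq_zero_of_lt (by omega), map_zero, zero_mul]

omit [IsUltrametricDist K] [CompleteSpace K] in
/-- Column sums: `∑_k logFssTerm k d · xᵈ = [Xᵈ]log_{F_ss} · xᵈ`. [folklore] -/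
theorem hasSum_col (x : K) (d : ℕ) :
    HasSum (fun k : ℕ => algebraMap ℚ_[p] K (logFssTerm p k d) * x ^ d)
      (algebraMap ℚ_[p] K (coeff d (logFss p)) * x ^ d) := by
  rw [coeff_logFss]
  have h := ((summable_logFssTerm p d).hasSum.map (algebraMap ℚ_[p] K) (continuous_algebraMap ℚ_[p] K)
    ).mul_right (x ^ d)
  exact h

omit [IsUltrametricDist K] in
/-- **Summability of the double family** `‖logFssTerm k d · xᵈ‖ ≤ (p⁻ᵏ)·(d‖x‖ᵈ)`. [folklore] -/
theorem summable_double {x : K} (hx : ‖x‖ < 1) :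
    Summable fun kd : ℕ × ℕ => algebraMap ℚ_[p] K (logFssTerm p kd.1 kd.2) * x ^ kd.2 := by
  have hr : (p : ℝ)⁻¹ < 1 := inv_lt_one_of_one_lt₀ (by exact_mod_cast hp.out.one_lt)
  have hg1 : Summable fun k : ℕ => (p : ℝ)⁻¹ ^ k := summable_geometric_of_lt_one (by positivity) hr
  have hg2 : Summable fun d : ℕ => (d : ℝ) * ‖x‖ ^ d := by
    simpa [pow_one] using summable_pow_mul_geometric_of_norm_lt_one 1 (r := ‖x‖) (by rwa [norm_norm])
  refine Summable.of_norm_bounded (hg1.mul_of_nonneg hg2 (fun k => by positivity) (fun d => by positivity)) ?_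
  rintro ⟨k, d⟩
  dsimp only
  rw [norm_mul, norm_pow, norm_algebraMap_padic]
  calc ‖logFssTerm p k d‖ * ‖x‖ ^ d ≤ (d * (p : ℝ)⁻¹ ^ k) * ‖x‖ ^ d :=
        mul_le_mul_of_nonneg_right (norm_logFssTerm_le p k d) (by positivity)
    _ = (p : ℝ)⁻¹ ^ k * (d * ‖x‖ ^ d) := by ring

/-! ## §2 `log_{F_ss}(x) = ∑ₖ (−1)ᵏ((1+x)^{p^{2k}} − 1)/pᵏ` -/

omit [IsUltrametricDist K] in
/-- **`∑ₖ (−1)ᵏ((1+x)^{p^{2k}} − 1)/pᵏ = log_{F_ss}(x)`** (`= qEval log_{F_ss} x`) for `‖x‖ < 1`: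
both iterated sums of the summable double family. [cite: Kobayashi2003, §8.2] -/
theorem hasSum_logFssRow {x : K} (hx : ‖x‖ < 1) :
    HasSum (fun k : ℕ => logFssRow p K x k) (qEval p K (logFss p) x) := by
  have hs := summable_double (p := p) hx
  -- rows
  have h1 : HasSum (fun k : ℕ => logFssRow p K x k) (∑' kd : ℕ × ℕ, algebraMap ℚ_[p] K (logFssTerm p kd.1 kd.2) * x ^ kd.2) :=
    hs.hasSum.prod_fiberwise fun k => hasSum_row x k
  -- columns
  have hs' := (Equiv.prodComm ℕ ℕ).summable_iff.mpr hs
  have h2 : HasSum (fun d : ℕ => algebraMap ℚ_[p] K (coeff d (logFss p)) * x ^ d)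
      (∑' dk : ℕ × ℕ, algebraMap ℚ_[p] K (logFssTerm p dk.2 dk.1) * x ^ dk.1) :=
    hs'.hasSum.prod_fiberwise fun d => hasSum_col x d
  have h3 := hasSum_qEval (K := K) (norm_coeff_logFss_le p) hx
  rw [h3.unique h2, ← (Equiv.prodComm ℕ ℕ).tsum_eq]
  exact h1

omit [IsUltrametricDist K] in
/-- `log_{F_ss}(x) = ∑' k, logFssRow x k`. [folklore] -/
theorem qEval_logFss_eq_tsum {x : K} (hx : ‖x‖ < 1) : qEval p K (logFss p) x = ∑' k : ℕ, logFssRow p K x k :=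
  (hasSum_logFssRow hx).tsum_eq.symm

omit [NormedAlgebra ℚ_[p] K] [IsUltrametricDist K] [CompleteSpace K] hp in
/-- A row vanishes when `(1+x)^{p^{2k}} = 1`. [folklore] -/
theorem logFssRow_eq_zero {x : K} {k : ℕ} (h : (1 + x) ^ p ^ (2 * k) = 1) : logFssRow p K x k = 0 := by
  rw [logFssRow, h, sub_self, mul_zero, zero_div]

omit [IsUltrametricDist K] in
/-- **Finite form**: if `(1+x)^{p^{2k}} = 1` for all `k ≥ k₀` then
`log_{F_ss}(x) = ∑_{k < k₀} (−1)ᵏ((1+x)^{p^{2k}} − 1)/pᵏ` (the case `x = ζ_{p^{n+1}} − 1` of [K] Lemma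
8.9). [cite: Kobayashi2003, Lemma 8.9] -/
theorem qEval_logFss_eq_sum_of_pow_eq_one {x : K} (hx : ‖x‖ < 1) {k₀ : ℕ}
    (h : ∀ k, k₀ ≤ k → (1 + x) ^ p ^ (2 * k) = 1) :
    qEval p K (logFss p) x = ∑ k ∈ range k₀, logFssRow p K x k := by
  refine (hasSum_logFssRow hx).unique (hasSum_sum_of_ne_finset_zero fun k hk => ?_)
  rw [mem_range, not_lt] at hk
  exact logFssRow_eq_zero (h k hk)

/-! ## §3 The congruence form `log_{F_ss}(x) ∈ K' + 𝒪_K` -/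

omit [CompleteSpace K] in
/-- `p`-th powers improve congruences: `‖a − b‖ ≤ ‖p‖ʲ`, `‖b‖ ≤ 1`, `j ≥ 1` ⇒ `‖aᵖ − bᵖ‖ ≤ ‖p‖^{j+1}`.
[folklore] -/
theorem norm_pow_p_sub_pow_p_le {a b : K} (hb : ‖b‖ ≤ 1) {j : ℕ} (hj : 1 ≤ j)
    (hab : ‖a - b‖ ≤ ‖(p : K)‖ ^ j) : ‖a ^ p - b ^ p‖ ≤ ‖(p : K)‖ ^ (j + 1) := by
  obtain ⟨hq0, hq1⟩ : 0 < ‖(p : K)‖ ∧ ‖(p : K)‖ < 1 := by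
    rw [norm_natCast_p]
    exact ⟨inv_pos.mpr (by exact_mod_cast hp.out.pos), inv_lt_one_of_one_lt₀ (by exact_mod_cast hp.out.one_lt)⟩
  set e := a - b with he
  have ha : a = b + e := by rw [he]; ring
  have he1 : ‖e‖ ≤ ‖(p : K)‖ ^ j := hab
  have he1' : ‖e‖ ≤ 1 := he1.trans (pow_le_one₀ hq0.le hq1.le)
  rw [ha, add_pow]
  -- split off the term `m = p` (which is `b^0 ... `): write the sum over `range (p+1)` as the `m=0` term `b^p`… we use
  -- `(b+e)^p - b^p = ∑_{m=1}^{p} e^m b^{p-m} C(p,m)` after reindexing `add_pow` with `x = e`? `add_pow` expands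
  -- `(b + e)^p = ∑ b^m e^{p-m} C(p,m)`; the `m = p` term is `b^p`.
  rw [Finset.sum_range_succ, Nat.choose_self, Nat.cast_one, mul_one, Nat.sub_self, pow_zero, mul_one,
    add_sub_cancel_right]
  refine IsUltrametricDist.norm_sum_le_of_forall_le_of_nonneg (by positivity) fun m hm => ?_
  rw [mem_range] at hm
  rw [norm_mul, norm_mul, norm_pow, norm_pow]
  have hpm : 1 ≤ p - m := Nat.one_le_iff_ne_zero.mpr (by omega)
  by_cases hm1 : p - m = 1
  · -- `m = p - 1`: the term is `p · b^{p-1} e`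
    have hmp : m = p - 1 := by omega
    rw [hm1, pow_one]
    have hC : ((p.choose m : ℕ) : K) = p := by
      rw [hmp, Nat.choose_symm hp.out.one_lt.le, Nat.choose_one_right]
    rw [hC]
    calc ‖b‖ ^ m * ‖e‖ * ‖(p : K)‖ ≤ 1 * ‖(p : K)‖ ^ j * ‖(p : K)‖ := by
          refine mul_le_mul (mul_le_mul (pow_le_one₀ (norm_nonneg _) hb) he1 (norm_nonneg _) zero_le_one) le_rfl
            (norm_nonneg _) (by positivity)
      _ = ‖(p : K)‖ ^ (j + 1) := by rw [one_mul, pow_succ]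
  · -- `p - m ≥ 2`: `‖e‖^{p-m} ≤ ‖p‖^{2j} ≤ ‖p‖^{j+1}`
    have h2 : 2 ≤ p - m := by omega
    have hC : ‖((p.choose m : ℕ) : K)‖ ≤ 1 := by
      have : ((p.choose m : ℕ) : K) = algebraMap ℚ_[p] K ((p.choose m : ℕ) : ℚ_[p]) := by rw [map_natCast]
      rw [this, norm_algebraMap_padic]
      simpa using Padic.norm_int_le_one (p := p) (p.choose m : ℤ)
    calc ‖b‖ ^ m * ‖e‖ ^ (p - m) * ‖((p.choose m : ℕ) : K)‖ ≤ 1 * (‖(p : K)‖ ^ j) ^ 2 * 1 := by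
          refine mul_le_mul (mul_le_mul (pow_le_one₀ (norm_nonneg _) hb) ?_ (by positivity) zero_le_one) hC
            (norm_nonneg _) (by positivity)
          calc ‖e‖ ^ (p - m) ≤ ‖e‖ ^ 2 := pow_le_pow_of_le_one (norm_nonneg _) he1' h2
            _ ≤ (‖(p : K)‖ ^ j) ^ 2 := pow_le_pow_left₀ (norm_nonneg _) he1 2
      _ = ‖(p : K)‖ ^ (2 * j) := by rw [one_mul, mul_one, ← pow_mul, mul_comm]
      _ ≤ ‖(p : K)‖ ^ (j + 1) := pow_le_pow_of_le_one hq0.le hq1.le (by omega)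

omit [CompleteSpace K] in
/-- From `yᵖ ∈ (K' ∩ 𝒪) + p𝒪` for all `y ∈ 𝒪` to **`y^{pʲ} ∈ (K' ∩ 𝒪) + pʲ𝒪`** for `j ≥ 1`.
[cite: Kobayashi2003, Prop. 8.11 (proof)] -/
theorem exists_norm_pow_sub_le (K' : Subfield K)
    (hFrob : ∀ y : K, ‖y‖ ≤ 1 → ∃ s ∈ K', ‖s‖ ≤ 1 ∧ ‖y ^ p - s‖ ≤ ‖(p : K)‖)
    {y : K} (hy : ‖y‖ ≤ 1) {j : ℕ} (hj : 1 ≤ j) :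
    ∃ s ∈ K', ‖s‖ ≤ 1 ∧ ‖y ^ p ^ j - s‖ ≤ ‖(p : K)‖ ^ j := by
  induction j, hj using Nat.le_induction with
  | base =>
    obtain ⟨s, hs, hs1, h⟩ := hFrob y hy
    exact ⟨s, hs, hs1, by simpa using h⟩
  | succ j hj ih =>
    obtain ⟨s, hs, hs1, h⟩ := ih
    refine ⟨s ^ p, K'.pow_mem hs p, by rw [norm_pow]; exact pow_le_one₀ (norm_nonneg _) hs1, ?_⟩
    rw [pow_succ, pow_mul]
    exact norm_pow_p_sub_pow_p_le hs1 hj h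

/-- **`log_{F_ss}(x) ∈ K' + 𝒪_K`**: for a subfield `K'` such that every `y ∈ 𝒪_K` has
`yᵖ ∈ (K' ∩ 𝒪_K) + p𝒪_K`, and every `‖x‖ < 1`, there is `μ ∈ K'` with `‖log_{F_ss}(x) − μ‖ ≤ 1`.
(The rows: `(1+x)^{p^{2k}} = s_k + e_k`, `‖e_k‖ ≤ ‖p‖^{2k}`, so row `k` is `±(s_k − 1)/pᵏ ± e_k/pᵏ`
with `‖e_k/pᵏ‖ ≤ ‖p‖ᵏ ≤ 1`; the tail of the convergent series is eventually of norm `≤ 1`.)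
[cite: Kobayashi2003, Prop. 8.11 (proof)] -/
theorem exists_mem_norm_qEval_logFss_sub_le_one (K' : Subfield K)
    (hFrob : ∀ y : K, ‖y‖ ≤ 1 → ∃ s ∈ K', ‖s‖ ≤ 1 ∧ ‖y ^ p - s‖ ≤ ‖(p : K)‖)
    {x : K} (hx : ‖x‖ < 1) : ∃ μ ∈ K', ‖qEval p K (logFss p) x - μ‖ ≤ 1 := by
  obtain ⟨hq0, hq1⟩ : 0 < ‖(p : K)‖ ∧ ‖(p : K)‖ < 1 := by
    rw [norm_natCast_p]
    exact ⟨inv_pos.mpr (by exact_mod_cast hp.out.pos), inv_lt_one_of_one_lt₀ (by exact_mod_cast hp.out.one_lt)⟩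
  have hp0 : (p : K) ≠ 0 := norm_pos_iff.mp hq0
  have hsum := hasSum_logFssRow (p := p) hx
  -- tail: rows tend to `0`, so eventually `‖row k‖ ≤ 1`
  have htend := hsum.summable.tendsto_atTop_zero
  rw [Metric.tendsto_atTop] at htend
  obtain ⟨N, hN⟩ := htend 1 one_pos
  have hN' : ∀ k, N ≤ k → ‖logFssRow p K x k‖ ≤ 1 := fun k hk => by
    have := hN k hk; rw [dist_zero_right] at this; exact this.le
  -- each row `k` is in `K' + 𝒪`
  have hrow : ∀ k, ∃ μ ∈ K', ‖logFssRow p K x k - μ‖ ≤ 1 := by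
    intro k
    rcases Nat.eq_zero_or_pos k with rfl | hk
    · refine ⟨0, K'.zero_mem, ?_⟩
      rw [sub_zero, logFssRow, pow_zero, one_mul, mul_zero, pow_zero, pow_one, pow_zero, div_one, add_sub_cancel_left]
      exact hx.le
    · have hy : ‖1 + x‖ ≤ 1 := (IsUltrametricDist.norm_add_le_max _ _).trans (max_le (by rw [norm_one]) hx.le)
      obtain ⟨s, hs, hs1, hse⟩ := exists_norm_pow_sub_le K' hFrob hy (show 1 ≤ 2 * k by omega)
      refine ⟨(-1) ^ k * (s - 1) / (p : K) ^ k, ?_, ?_⟩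
      · exact K'.div_mem (K'.mul_mem (K'.pow_mem (K'.neg_mem K'.one_mem) k) (K'.sub_mem hs K'.one_mem))
          (K'.pow_mem (natCast_mem K' p) k)
      · have e : logFssRow p K x k - (-1) ^ k * (s - 1) / (p : K) ^ k =
            (-1) ^ k * ((1 + x) ^ p ^ (2 * k) - s) / (p : K) ^ k := by
          rw [logFssRow]; field_simp; ring
        rw [e, norm_div, norm_mul, norm_pow, norm_neg, norm_one, one_pow, one_mul, norm_pow,
          div_le_iff₀ (pow_pos hq0 k), one_mul]
        calc ‖(1 + x) ^ p ^ (2 * k) - s‖ ≤ ‖(p : K)‖ ^ (2 * k) := hse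
          _ ≤ ‖(p : K)‖ ^ k := pow_le_pow_of_le_one hq0.le hq1.le (by omega)
  -- assemble: finite part + tail
  choose μ hμK hμ using hrow
  refine ⟨∑ k ∈ range N, μ k, K'.sum_mem fun k _ => hμK k, ?_⟩
  have hsplit : qEval p K (logFss p) x = (∑ k ∈ range N, logFssRow p K x k) + ∑' k : ℕ, logFssRow p K x (k + N) := by
    rw [← hsum.tsum_eq, ← hsum.summable.sum_add_tsum_nat_add N]
  rw [hsplit, add_sub_right_comm, ← Finset.sum_sub_distrib]
  refine (IsUltrametricDist.norm_add_le_max _ _).trans (max_le ?_ ?_)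
  · exact IsUltrametricDist.norm_sum_le_of_forall_le_of_nonneg zero_le_one fun k _ => hμ k
  · exact IsUltrametricDist.norm_tsum_le_of_forall_le_of_nonneg zero_le_one fun k => hN' _ (by omega)

end HondaFss

end Summit.BirchSwinnertonDyer.Rank1Residual.Additive

end
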